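import Mathlib
import HarnessLib
import Summits.NavierStokesRegularity.NavierStokesRegularity.Theorems.UnthreadedRigidityDoorUnthreadedRigidityVirialHornTwoChannelChanDecay

/-!
# Route `UnthreadedRigidityDoor`, item `UnthreadedRigidity` (W2, stmt-NavierStokesRegularity-27585) — LINE g11-1 «VIRIAL HORN»,
# BRIDGE V for PLATEAU PROFILES («TWO-CHANNEL RIGIDITY»), file 4b: THE TRIANGULAR RADIAL CASCADE OF A VIRIAL-ADMISSIBLE PROFILE

Prover file (W2 Lean hand ns-crc-p1 g10, by lineage; `--supports stmt-NavierStokesRegularity-27585 --as helper`; objects BY NAME in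
`Theorems/UnthreadedRigidityDoorUnthreadedRigidityVirialHornTwoChannelDefs.lean`, p726708 / p728780 and its second append).

Content: `abs_cascadeSrc_le` (source decay at every level in the weak form the cascade needs), ★ `cascadeCoeff_smooth_decay` (induction on
the level through the WEAK radial bound of file 3: `g_k` smooth and `|g_k| ≤ K/σ^{l−k+1}` for `k < l`), `cascadeCoeff_top`
(`|g_l(r²)| ≤ C/r`, g9's strong bound at `L = 0`, every `l ≥ 1`), the radial ODEs `cascadeCoeff_ode_zero/_succ` of every level on
`[0,∞)`, `contDiff_cascadeCoeff`.
HONEST LABEL: slice-level calculus / real analysis about SPECIAL (separable) data; a piece of the L-part of ONE bridge of a RUNG line on the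
wall item; `UnthreadedRigidity` (27585), W2 and NS regularity remain OPEN; nothing here is a statement about Navier–Stokes regularity.  0 kit.
-/

-- the summit and its single sub-problem share the name (CONVENTIONS §1), as in every Theorems file
set_option linter.dupNamespace false

namespace Summit.NavierStokesRegularity.NavierStokesRegularity.Theorems.UnthreadedRigidity.VirialHorn

open scoped RealInnerProductSpace Topology Laplacian
open Filter Set MvPolynomial
open Literature.Combinatorics.LorentzianPolynomials (pderiv_pderiv_comm)
open Summit.NavierStokesRegularity.NavierStokesRegularity.Theorems.UnthreadedRigidity.ProfileHorn (E3)
open Summit.NavierStokesRegularity.NavierStokesRegularity.Theorems.UnthreadedRigidity.HornPressure (radCoeff)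
open Summit.NavierStokesRegularity.NavierStokesRegularity.Theorems.PoloidalLiouville.HorizonTower hiding E3


/-! ## §5b The triangular radial cascade of a virial-admissible profile -/

section Cascade

open scoped ContDiff

variable {l : ℕ} {H h : ℝ → ℝ} {C : ℝ}

/-- weakening a power decay bound on `[1,∞)`. -/
theorem decay_mono {f : ℝ → ℝ} {K : ℝ} {p q : ℕ} (hpq : q ≤ p) (hf : ∀ σ : ℝ, 1 ≤ σ → |f σ| ≤ K / σ ^ p) :
    ∀ σ : ℝ, 1 ≤ σ → |f σ| ≤ K / σ ^ q := by
  intro σ hσ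
  have hK : 0 ≤ K := le_trans (abs_nonneg _) (by simpa using hf 1 le_rfl)
  refine (hf σ hσ).trans (div_le_div_of_nonneg_left hK (by positivity) (pow_le_pow_right₀ hσ hpq))

/-- adding two decay bounds with the same exponent. -/
theorem decay_add {f g : ℝ → ℝ} {K K' : ℝ} {p : ℕ} (hf : ∀ σ : ℝ, 1 ≤ σ → |f σ| ≤ K / σ ^ p)
    (hg : ∀ σ : ℝ, 1 ≤ σ → |g σ| ≤ K' / σ ^ p) :
    ∀ σ : ℝ, 1 ≤ σ → |f σ + g σ| ≤ (K + K') / σ ^ p := by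
  intro σ hσ
  rw [add_div]
  exact (abs_add_le _ _).trans (add_le_add (hf σ hσ) (hg σ hσ))

/-- scaling a decay bound by a nonnegative constant. -/
theorem decay_const_mul {f : ℝ → ℝ} {K c : ℝ} {p : ℕ} (hc : 0 ≤ c) (hf : ∀ σ : ℝ, 1 ≤ σ → |f σ| ≤ K / σ ^ p) :
    ∀ σ : ℝ, 1 ≤ σ → |c * f σ| ≤ (c * K) / σ ^ p := by
  intro σ hσ
  rw [abs_mul, abs_of_nonneg hc, mul_div_assoc]
  exact mul_le_mul_of_nonneg_left (hf σ hσ) hc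

/-- DECAY OF THE SOURCE AT LEVEL `k` in the (weak) form the cascade needs: `|cascadeSrc l h k σ| ≤ K/σ^{l−k+2}` (`k ≤ l`). -/
theorem abs_cascadeSrc_le (hl : 1 ≤ l) (hh : ContDiff ℝ ∞ h) (hHh : ∀ r : ℝ, 0 ≤ r → H r = h (r ^ 2))
    (hC : ∀ r : ℝ, 1 ≤ r → r ^ (l + 2) * |H r| ≤ C ∧ r ^ (l + 3) * |deriv H r| ≤ C ∧ r ^ (l + 4) * |deriv (deriv H) r| ≤ C)
    (k : ℕ) : ∃ K : ℝ, ∀ σ : ℝ, 1 ≤ σ → |cascadeSrc l h k σ| ≤ K / σ ^ (l - k + 2) := by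
  match k with
  | 0 =>
    obtain ⟨K, hK⟩ := abs_chanY_le hl hh hHh hC
    exact ⟨K, decay_mono (by omega) hK⟩
  | 1 =>
    obtain ⟨K, hK⟩ := abs_chanG_le hl hh hHh hC
    refine ⟨(1 / 2) * K, fun σ hσ => ?_⟩
    have := decay_const_mul (c := 1 / 2) (by norm_num) (decay_mono (q := l - 1 + 2) (by omega) hK) σ hσ
    simpa [cascadeSrc, div_eq_mul_inv, mul_comm] using this
  | 2 =>
    obtain ⟨K, hK⟩ := abs_ampA_sq_le hl hh hHh hC
    refine ⟨(1 / 4) * K, fun σ hσ => ?_⟩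
    have := decay_const_mul (c := 1 / 4) (by norm_num) (decay_mono (q := l - 2 + 2) (by omega) hK) σ hσ
    simpa [cascadeSrc, div_eq_mul_inv, mul_comm] using this
  | k + 3 =>
    refine ⟨0, fun σ hσ => ?_⟩
    simp [cascadeSrc]

/-- unfolding the recursion: level `0`. -/
theorem cascadeCoeff_zero (l : ℕ) (h : ℝ → ℝ) : cascadeCoeff l h 0 = radCoeff (2 * l) (chanY l h) := rfl

/-- unfolding the recursion: level `k+1`. -/
theorem cascadeCoeff_succ (l : ℕ) (h : ℝ → ℝ) (k : ℕ) :
    cascadeCoeff l h (k + 1) = radCoeff (2 * l - 2 * (k + 1)) (fun s => cascadeSrc l h (k + 1) s + cascadeCoeff l h k s) := rfl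

/-- ★ THE CASCADE BELOW THE TOP LEVEL: for `k + 1 ≤ l` the coefficient `g_k` is smooth and decays like `σ^{−(l−k+1)}` on `[1,∞)`
(induction on `k` through the WEAK-decay bound of the radial layer). -/
theorem cascadeCoeff_smooth_decay (hl : 1 ≤ l) (hh : ContDiff ℝ ∞ h) (hHh : ∀ r : ℝ, 0 ≤ r → H r = h (r ^ 2))
    (hC : ∀ r : ℝ, 1 ≤ r → r ^ (l + 2) * |H r| ≤ C ∧ r ^ (l + 3) * |deriv H r| ≤ C ∧ r ^ (l + 4) * |deriv (deriv H) r| ≤ C) :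
    ∀ k : ℕ, k + 1 ≤ l →
      ContDiff ℝ ∞ (cascadeCoeff l h k) ∧ ∃ K : ℝ, ∀ σ : ℝ, 1 ≤ σ → |cascadeCoeff l h k σ| ≤ K / σ ^ (l - k + 1) := by
  intro k
  induction k with
  | zero =>
    intro h1
    obtain ⟨K, hK⟩ := abs_chanY_le hl hh hHh hC
    have hK' : ∀ σ : ℝ, 1 ≤ σ → |chanY l h σ| ≤ K / σ ^ (l + 2) := decay_mono (by omega) hK
    refine ⟨?_, ?_⟩
    · rw [cascadeCoeff_zero]
      exact contDiff_radCoeff_of_decay (m := l) (contDiff_chanY hh l) (2 * l) hK'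
    · obtain ⟨K₁, hK₁⟩ := abs_radCoeff_le_weak (contDiff_chanY hh l).continuous (2 * l) (l + 2) (by omega) (by omega) hK'
      refine ⟨K₁, fun σ hσ => ?_⟩
      rw [cascadeCoeff_zero, show l - 0 + 1 = l + 2 - 1 by omega]
      exact hK₁ σ hσ
  | succ k ih =>
    intro hk
    obtain ⟨ihc, K, hK⟩ := ih (by omega)
    obtain ⟨K', hK'⟩ := abs_cascadeSrc_le hl hh hHh hC (k + 1)
    -- the source of level `k+1`
    have hsrc_c : ContDiff ℝ ∞ (fun s => cascadeSrc l h (k + 1) s + cascadeCoeff l h k s) :=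
      (contDiff_cascadeSrc hh l (k + 1)).add ihc
    have hsrc_d : ∀ σ : ℝ, 1 ≤ σ → |cascadeSrc l h (k + 1) σ + cascadeCoeff l h k σ| ≤ (K' + K) / σ ^ (l - k + 1) := by
      have h1 : ∀ σ : ℝ, 1 ≤ σ → |cascadeSrc l h (k + 1) σ| ≤ K' / σ ^ (l - k + 1) := by
        rw [show l - k + 1 = l - (k + 1) + 2 by omega]; exact hK'
      exact decay_add h1 hK
    refine ⟨?_, ?_⟩
    · rw [cascadeCoeff_succ]
      exact contDiff_radCoeff_of_decay (m := l - k - 1) hsrc_c _ (by rw [show l - k - 1 + 2 = l - k + 1 by omega]; exact hsrc_d)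
    · obtain ⟨K₁, hK₁⟩ := abs_radCoeff_le_weak hsrc_c.continuous (2 * l - 2 * (k + 1)) (l - k + 1) (by omega) (by omega) hsrc_d
      refine ⟨K₁, fun σ hσ => ?_⟩
      rw [cascadeCoeff_succ, show l - (k + 1) + 1 = l - k + 1 - 1 by omega]
      exact hK₁ σ hσ

/-- THE TOP LEVEL `k = l` (`l ≥ 1`): `g_l` is smooth and `|g_l(r²)| ≤ C/r` (g9's strong bound at `L = 0`; the source of the top
level is `cascadeSrc l l + g_{l−1}`, which decays like `σ^{−2}`). -/
theorem cascadeCoeff_top (hl : 1 ≤ l) (hh : ContDiff ℝ ∞ h) (hHh : ∀ r : ℝ, 0 ≤ r → H r = h (r ^ 2))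
    (hC : ∀ r : ℝ, 1 ≤ r → r ^ (l + 2) * |H r| ≤ C ∧ r ^ (l + 3) * |deriv H r| ≤ C ∧ r ^ (l + 4) * |deriv (deriv H) r| ≤ C) :
    ContDiff ℝ ∞ (cascadeCoeff l h l) ∧ ∃ K : ℝ, ∀ r : ℝ, 1 ≤ r → |cascadeCoeff l h l (r ^ 2)| ≤ K / r := by
  obtain ⟨j, rfl⟩ : ∃ j, l = j + 1 := ⟨l - 1, by omega⟩
  obtain ⟨ihc, K, hK⟩ := cascadeCoeff_smooth_decay (by omega) hh hHh hC j (by omega)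
  obtain ⟨K', hK'⟩ := abs_cascadeSrc_le (l := j + 1) (by omega) hh hHh hC (j + 1)
  have hsrc_c : ContDiff ℝ ∞ (fun s => cascadeSrc (j + 1) h (j + 1) s + cascadeCoeff (j + 1) h j s) :=
    (contDiff_cascadeSrc hh (j + 1) (j + 1)).add ihc
  have hK2 : ∀ σ : ℝ, 1 ≤ σ → |cascadeSrc (j + 1) h (j + 1) σ + cascadeCoeff (j + 1) h j σ| ≤ (K' + K) / σ ^ 2 := by
    have h1 : ∀ σ : ℝ, 1 ≤ σ → |cascadeSrc (j + 1) h (j + 1) σ| ≤ K' / σ ^ 2 := by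
      rw [show (2 : ℕ) = j + 1 - (j + 1) + 2 by omega]; exact hK'
    have h2 : ∀ σ : ℝ, 1 ≤ σ → |cascadeCoeff (j + 1) h j σ| ≤ K / σ ^ 2 := by
      rw [show (2 : ℕ) = j + 1 - j + 1 by omega]; exact hK
    exact decay_add h1 h2
  have hL : 2 * (j + 1) - 2 * (j + 1) = 0 := by omega
  have heq : cascadeCoeff (j + 1) h (j + 1) =
      radCoeff 0 (fun s => cascadeSrc (j + 1) h (j + 1) s + cascadeCoeff (j + 1) h j s) := by
    rw [cascadeCoeff_succ, hL]
  refine ⟨?_, ?_⟩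
  · rw [heq]; exact contDiff_radCoeff_of_decay (m := 0) hsrc_c 0 hK2
  · rw [heq]; exact abs_radCoeff_zero_sq_le hsrc_c hK2

/-- THE RADIAL ODE AT LEVEL `0`: `4s g₀″ + (8l+6) g₀′ = −chanY` on `[0,∞)`. -/
theorem cascadeCoeff_ode_zero (hl : 1 ≤ l) (hh : ContDiff ℝ ∞ h) (hHh : ∀ r : ℝ, 0 ≤ r → H r = h (r ^ 2))
    (hC : ∀ r : ℝ, 1 ≤ r → r ^ (l + 2) * |H r| ≤ C ∧ r ^ (l + 3) * |deriv H r| ≤ C ∧ r ^ (l + 4) * |deriv (deriv H) r| ≤ C)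
    {s : ℝ} (hs : 0 ≤ s) :
    4 * s * deriv (deriv (cascadeCoeff l h 0)) s + (4 * ((2 * l : ℕ) : ℝ) + 6) * deriv (cascadeCoeff l h 0) s
      = -chanY l h s := by
  obtain ⟨K, hK⟩ := abs_chanY_le hl hh hHh hC
  rw [cascadeCoeff_zero]
  exact radCoeff_ode_of_decay (m := l + 2) (contDiff_chanY hh l) (2 * l) hK hs

/-- THE RADIAL ODE AT LEVEL `k+1 ≤ l`: `4s g″ + (4(2l−2k−2)+6) g′ = −(cascadeSrc (k+1) + g_k)` on `[0,∞)`. -/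
theorem cascadeCoeff_ode_succ (hl : 1 ≤ l) (hh : ContDiff ℝ ∞ h) (hHh : ∀ r : ℝ, 0 ≤ r → H r = h (r ^ 2))
    (hC : ∀ r : ℝ, 1 ≤ r → r ^ (l + 2) * |H r| ≤ C ∧ r ^ (l + 3) * |deriv H r| ≤ C ∧ r ^ (l + 4) * |deriv (deriv H) r| ≤ C)
    {k : ℕ} (hk : k + 1 ≤ l) {s : ℝ} (hs : 0 ≤ s) :
    4 * s * deriv (deriv (cascadeCoeff l h (k + 1))) s
        + (4 * ((2 * l - 2 * (k + 1) : ℕ) : ℝ) + 6) * deriv (cascadeCoeff l h (k + 1)) s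
      = -(cascadeSrc l h (k + 1) s + cascadeCoeff l h k s) := by
  obtain ⟨ihc, K, hK⟩ := cascadeCoeff_smooth_decay hl hh hHh hC k hk
  obtain ⟨K', hK'⟩ := abs_cascadeSrc_le hl hh hHh hC (k + 1)
  have hsrc_c : ContDiff ℝ ∞ (fun s => cascadeSrc l h (k + 1) s + cascadeCoeff l h k s) :=
    (contDiff_cascadeSrc hh l (k + 1)).add ihc
  have hsrc_d : ∀ σ : ℝ, 1 ≤ σ → |cascadeSrc l h (k + 1) σ + cascadeCoeff l h k σ| ≤ (K' + K) / σ ^ (l - k - 1 + 2) := by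
    have h1 : ∀ σ : ℝ, 1 ≤ σ → |cascadeSrc l h (k + 1) σ| ≤ K' / σ ^ (l - k - 1 + 2) := by
      rw [show l - k - 1 + 2 = l - (k + 1) + 2 by omega]; exact hK'
    have h2 : ∀ σ : ℝ, 1 ≤ σ → |cascadeCoeff l h k σ| ≤ K / σ ^ (l - k - 1 + 2) := by
      rw [show l - k - 1 + 2 = l - k + 1 by omega]; exact hK
    exact decay_add h1 h2
  rw [cascadeCoeff_succ]
  exact radCoeff_ode_of_decay (m := l - k - 1) hsrc_c _ hsrc_d hs

/-- every level `k ≤ l` of the cascade is smooth in `s`. -/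
theorem contDiff_cascadeCoeff (hl : 1 ≤ l) (hh : ContDiff ℝ ∞ h) (hHh : ∀ r : ℝ, 0 ≤ r → H r = h (r ^ 2))
    (hC : ∀ r : ℝ, 1 ≤ r → r ^ (l + 2) * |H r| ≤ C ∧ r ^ (l + 3) * |deriv H r| ≤ C ∧ r ^ (l + 4) * |deriv (deriv H) r| ≤ C)
    {k : ℕ} (hk : k ≤ l) : ContDiff ℝ ∞ (cascadeCoeff l h k) := by
  rcases Nat.lt_or_ge k l with hlt | hge
  · exact (cascadeCoeff_smooth_decay (by omega) hh hHh hC k (by omega)).1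
  · have : k = l := le_antisymm hk hge
    subst this
    exact (cascadeCoeff_top hl hh hHh hC).1

end Cascade

end Summit.NavierStokesRegularity.NavierStokesRegularity.Theorems.UnthreadedRigidity.VirialHorn
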